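import Summits.QuantumFields.BalabanUV.T4Continuum.Spine.NE3.SlicePoincareSlicB8Flat
import Summits.QuantumFields.BalabanUV.T4Continuum.Spine.NE3.SlicB8LandauReduction
import HarnessLib

/-!
# T⁴ programme, node NE3 — census R32 (assembly, file 1): THE SPIKE-CORRECTED TANGENT REPRESENTATIVE OF A DIRECTION IN B8's SLICE AT THE
# FLAT BACKGROUND, EVERY TORUS SIZE `N`, and the matrix helpers of the assembly (skew part, flat site Laplacian in coboundary form)

Cell `pub-balaban-gaps` (track G2, seat `ne3`; writer prover-pub-balaban-gaps-ne3-g6-0, 2026-08-23), census `run/shared/lean/pub/pub-balaban-gaps/ne/NE3.md`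
§4 R32 ∕ §12.  WHY.  The flat (P♮) on `slicB8` for every `N` (file 2, `SlicePoincareSlicB8FlatAllN`) pays the coarse datum of the exact sector
in curl through the tree's S-bound `NE3HodgeCoexactPoincareEnd.sum_nhsNormSq_iterate_Qcoarse_coexact_le_curl`, which is stated for PLAIN-fibre
tangent directions; a direction `Y` with `QbarIter L (j+1) 1 Y = 0` becomes plain-fibre tangent after adding the coboundary of the corner spike
of its accumulated frames (R25, `TangentProjectionSlicB8.tangentIter_sub_gaugeDir_of_QbarIter_eq_zero`) — same flat curl, same co-closed
Hodge component.  `SlicB8FlatCoexact` (p362018) used this construction inline; THIS FILE exports it: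
**`exists_tangentRep_of_QbarIter_flatCfg`** — for `L ≥ 2`, `N ≥ 1`, skew `(N·L^{j+1})`-periodic `Y` with `QbarIter L (j+1) flatCfg Y = 0` there is
a skew `(N·L^{j+1})`-periodic `ζ` with `TangentIter L j flat (Y + dPot ζ)`.  Plus the matrix helpers of file 2: the skew part `½(X − Xᴴ)`
(`half_sub_ct_mem`, `nhsNormSq_half_sub_ct_le`, `half_sub_ct_sub`, `half_sub_ct_sum`, `half_sub_ct_of_skew`), the flat site Laplacian in
coboundary form (`nhsNormSq_covLapSite_flatCfg`: `nhsNormSq (covLapSite 1 u y) = nhsNormSq (Σ_μ (dPot u y μ − dPot u (y − e_μ) μ))`).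

CONTENT (0 sorry, no `def`) [folklore].

HONEST FRAMING.  Lattice kinematics at the TRIVIAL background; nothing about curved backgrounds or Bałaban's minimisers; **NE3 is NOT proved**;
spine PROVED 0∕9; finite T⁴ rung (B)+1 — NOT continuum YM on ℝ⁴, NOT infinite volume, NOT mass gap, NOT Clay.
PLACEMENT: `Summits/QuantumFields/BalabanUV/T4Continuum/Spine/NE3/`.
-/

set_option autoImplicit false

open scoped BigOperators Matrix Matrix.Norms.L2Operator
open Finset

namespace Summit.QuantumFields.BalabanUV.T4Continuum.NE3.SlicB8FlatTangentRep

open Literature.MathematicalPhysics.QuantumFieldTheory.Balaban1983to89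
open B7Prop1Explicit B7Prop2Explicit
open T4AveragingDeficitWall (IsUnitaryCfg IsSkewDir SmallField Ad Plane curlAt curlSq dirSq)
open T4AveragingDeficitWallBoundary (IsPeriodicCfg periodBox mem_periodBox card_periodBox)
open AveragingDeficitPeriodicCounting (IsPeriodicDir)
open AveragingDeficitMultiLevelPrep (TangentIter tower LevelSmall)
open BlockAveragePushDirGauge (gaugeDir isPeriodicDir_gaugeDir)
open BlockAveragePushDirSplit (flat)
open MinimalActionWitness (flatCfg isPeriodicCfg_flatCfg)
open NE3TangentCovariantTower (QbarIter framePotW QbarIter_flat)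
open NE3CurvedFrameKill (framePotW_skew_periodic)
open NE3FramePotBoundW (tower_eq_pow_mul)
open NE3TangentNoGoWords (dPot)
open NE3TangentFlatStructure (Qcoarse)
open NE3CoercivityScaling (flatDiv)
open MatrixNorms (nhsNormSq nhsNormSq_nonneg nhsNormSq_conjTranspose nhsNormSq_le_opNorm_sq opNorm_sq_le_card_mul_nhsNormSq)
open AveragingDeficitHSInner (nhsNormSq_smul)
open NE3CovariantCalculus (nhsNormSq_sub_le nhsNormSq_neg)
open NE3CovariantWeitzenbock (covDiv)
open NE3CovariantBlockMean (bmeanIterW)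
open NE3NestedBlockMeanCovariance (bmeanIterW_one)
open NE3FramePotGauge (bmean iterate_bmean_apply iterate_Qcoarse_dPot iterate_Qcoarse_add)
open NE3FrameFreeSliceUnique (gaugeDir_flatCfg_eq_neg_dPot covDiv_flatCfg_eq_flatDiv)
open NE3FlatHessianCurl (isUnitaryCfg_flatCfg smallField_flatCfg_zero)
open NE3BlockPoincareTangent (dirSq_le_card_mul_sum_nhs)
open NE3FlatWeightedCoercive (sum_nhsNormSq_curl_le_curlSq)
open NE3HodgeCoexactPoincareEnd (sum_nhsNormSq_iterate_Qcoarse_coexact_le_curl curlAt_flatCfg_coexact)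
open NE3SlicePoincareShape (SlicePoincare)
open NE3.PairLandauB8 (covLapSite avgKernelGauges IsLandauB8)
open NE3.LandauProjectionB8 (covDiv_gaugeDir_eq_covLapSite)
open NE3.TangentProjectionSlicB8 (tangentIter_sub_gaugeDir_of_QbarIter_eq_zero)
open NE3.PairLandauB8Avg (slicB8 mem_slicB8_iff)
open NE3.SlicePoincareSlicB8Flat (levelSmall_zero cornerSmall_zero flatCfg_eq_one)

noncomputable section

variable {d : ℕ} {n : Type*} [Fintype n] [DecidableEq n]

/-! ## §1 Matrix helpers: the skew part, and the flat site Laplacian in coboundary form -/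

omit [Fintype n] [DecidableEq n] in
/-- The skew part `½(X − Xᴴ)` is skew-Hermitian. [folklore] -/
theorem half_sub_ct_mem (X : Matrix n n ℂ) : (1 / 2 : ℝ) • (X - Xᴴ) ∈ skewAdjoint (Matrix n n ℂ) := by
  rw [skewAdjoint.mem_iff, star_smul, star_trivial, Matrix.star_eq_conjTranspose, Matrix.conjTranspose_sub,
    Matrix.conjTranspose_conjTranspose, ← smul_neg, neg_sub]

/-- The skew part does not increase the normalised Hilbert–Schmidt norm: `nhsNormSq (½(X − Xᴴ)) ≤ nhsNormSq X`. [folklore] -/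
theorem nhsNormSq_half_sub_ct_le (X : Matrix n n ℂ) : nhsNormSq ((1 / 2 : ℝ) • (X - Xᴴ)) ≤ nhsNormSq X := by
  rw [nhsNormSq_smul]
  have h := nhsNormSq_sub_le X Xᴴ
  rw [nhsNormSq_conjTranspose] at h
  nlinarith [nhsNormSq_nonneg X]

omit [Fintype n] [DecidableEq n] in
/-- The skew part is additive: differences. [folklore] -/
theorem half_sub_ct_sub (X Y : Matrix n n ℂ) :
    (1 / 2 : ℝ) • ((X - Y) - (X - Y)ᴴ) = (1 / 2 : ℝ) • (X - Xᴴ) - (1 / 2 : ℝ) • (Y - Yᴴ) := by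
  rw [Matrix.conjTranspose_sub, ← smul_sub]; congr 1; abel

omit [Fintype n] [DecidableEq n] in
/-- The skew part is additive: finite sums. [folklore] -/
theorem half_sub_ct_sum {ι : Type*} (s : Finset ι) (f : ι → Matrix n n ℂ) :
    (1 / 2 : ℝ) • ((∑ i ∈ s, f i) - (∑ i ∈ s, f i)ᴴ) = ∑ i ∈ s, (1 / 2 : ℝ) • (f i - (f i)ᴴ) := by
  rw [Matrix.conjTranspose_sum, ← Finset.sum_sub_distrib, Finset.smul_sum]

omit [Fintype n] [DecidableEq n] in
/-- A skew matrix is its own skew part: if `Sᴴ = −S` then `½(S − Sᴴ) = S`. [folklore] -/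
theorem half_sub_ct_of_skew {S : Matrix n n ℂ} (hS : S ∈ skewAdjoint (Matrix n n ℂ)) : (1 / 2 : ℝ) • (S - Sᴴ) = S := by
  rw [skewAdjoint.mem_iff, Matrix.star_eq_conjTranspose] at hS
  rw [hS, sub_neg_eq_add, ← two_smul ℝ S, smul_smul]
  norm_num

/-- **THE FLAT SITE LAPLACIAN IN COBOUNDARY FORM**: `nhsNormSq (covLapSite 1 u y) = nhsNormSq (Σ_μ (dPot u y μ − dPot u (y − e_μ) μ))`. [folklore] -/
theorem nhsNormSq_covLapSite_flatCfg (u : Site d → Matrix n n ℂ) (y : Site d) :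
    nhsNormSq (covLapSite (flatCfg : Site d → Fin d → (Matrix n n ℂ)ˣ) u y) = nhsNormSq (∑ μ : Fin d, (dPot u y μ - dPot u (y - e μ) μ)) := by
  have h : covLapSite (flatCfg : Site d → Fin d → (Matrix n n ℂ)ˣ) u y = -(∑ μ : Fin d, (dPot u y μ - dPot u (y - e μ) μ)) := by
    rw [← congrFun (covDiv_gaugeDir_eq_covLapSite (flatCfg : Site d → Fin d → (Matrix n n ℂ)ˣ) u) y, covDiv_flatCfg_eq_flatDiv]
    unfold flatDiv
    rw [← Finset.sum_neg_distrib]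
    refine Finset.sum_congr rfl fun μ _ => ?_
    rw [gaugeDir_flatCfg_eq_neg_dPot, gaugeDir_flatCfg_eq_neg_dPot]
    abel
  rw [h, nhsNormSq_neg]

/-! ## §2 The tangent representative of a direction in the kernel of the k-fold double-bar average (the corner spike, every `N`) -/

/-- **THE SPIKE-CORRECTED TANGENT REPRESENTATIVE** (R25, every `N`): for `L ≥ 2`, `N ≥ 1` and a skew `(N·L^{j+1})`-periodic `Y` with
`QbarIter L (j+1) flatCfg Y = 0` there is a skew `(N·L^{j+1})`-periodic `ζ` (the corner spike of the accumulated frames) with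
`TangentIter L j flat (Y + dPot ζ)` — a PLAIN-fibre tangent direction with the same flat curl and the same co-closed Hodge component. [folklore] -/
theorem exists_tangentRep_of_QbarIter_flatCfg [Nonempty n] {L N : ℕ} [NeZero N] (hL : 2 ≤ L) (j : ℕ)
    {Y : Site d → Fin d → Matrix n n ℂ} (hYs : IsSkewDir Y) (hYP : IsPeriodicDir Y ((N * L ^ (j + 1) : ℕ) : ℤ))
    (hQ : QbarIter L (j + 1) (flatCfg : Site d → Fin d → (Matrix n n ℂ)ˣ) Y = fun _ _ => 0) :
    ∃ ζ : Site d → Matrix n n ℂ, (∀ y, ζ y ∈ skewAdjoint (Matrix n n ℂ)) ∧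
      (∀ (y : Site d) (i : Fin d), ζ (y + ((N * L ^ (j + 1) : ℕ) : ℤ) • e i) = ζ y) ∧
      TangentIter L j (flat (d := d) (n := n)) (fun y κ => Y y κ + dPot ζ y κ) := by
  have hL1 : 1 ≤ L := le_trans (by norm_num) hL
  set M : ℕ := L ^ (j + 1) with hM
  have hMpos : 0 < M := by rw [hM]; positivity
  have hM0 : (M : ℤ) ≠ 0 := by exact_mod_cast hMpos.ne'
  have hMZ : ((M : ℕ) : ℤ) = (L : ℤ) ^ (j + 1) := by rw [hM]; push_cast; rfl
  have hPM : N * L ^ (j + 1) = M * N := by rw [hM, Nat.mul_comm]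
  have htower : tower L N (j + 1) = M * N := by rw [tower_eq_pow_mul]
  have hWu : IsUnitaryCfg (flatCfg : Site d → Fin d → (Matrix n n ℂ)ˣ) := isUnitaryCfg_flatCfg
  have hWP_T : IsPeriodicCfg (flatCfg : Site d → Fin d → (Matrix n n ℂ)ˣ) ((tower L N (j + 1) : ℕ) : ℤ) := isPeriodicCfg_flatCfg _
  have hYP_T : IsPeriodicDir Y ((tower L N (j + 1) : ℕ) : ℤ) := by rw [htower, ← hPM]; exact hYP
  have hs0 : LevelSmall d L j 0 := levelSmall_zero hL j
  obtain ⟨hfs, hfP⟩ := framePotW_skew_periodic (M := N) hL1 j hWu hWP_T le_rfl hs0 smallField_flatCfg_zero hYs hYP_T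
  set f : Site d → Matrix n n ℂ := framePotW L (j + 1) (flatCfg : Site d → Fin d → (Matrix n n ℂ)ˣ) Y with hf
  set ζ : Site d → Matrix n n ℂ := fun y => if (∀ i, (M : ℤ) ∣ y i) then f (fun i => y i / (M : ℤ)) else 0 with hζ
  have hζ_of : ∀ y : Site d, (∀ i, (M : ℤ) ∣ y i) → ζ y = f (fun i => y i / (M : ℤ)) := fun y h => by
    simp only [hζ, if_pos h]
  have hζ_off : ∀ y : Site d, ¬ (∀ i, (M : ℤ) ∣ y i) → ζ y = 0 := fun y h => by
    simp only [hζ, if_neg h]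
  have hcorner' : ∀ z : Site d, ζ (((L : ℤ) ^ (j + 1)) • z) = framePotW L (j + 1) (flatCfg : Site d → Fin d → (Matrix n n ℂ)ˣ) Y z := by
    intro z
    have hdiv : ∀ i, (M : ℤ) ∣ ((M : ℤ) • z) i := fun i => by
      simp only [Pi.smul_apply, smul_eq_mul]; exact dvd_mul_right _ _
    rw [← hMZ, hζ_of _ hdiv]
    show f _ = f z
    congr 1
    funext i
    simp only [Pi.smul_apply, smul_eq_mul]
    exact Int.mul_ediv_cancel_left _ hM0
  have hζs : ∀ y, ζ y ∈ skewAdjoint (Matrix n n ℂ) := by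
    intro y
    by_cases hdiv : ∀ i, (M : ℤ) ∣ y i
    · rw [hζ_of y hdiv]; exact hfs _
    · rw [hζ_off y hdiv]; exact (skewAdjoint (Matrix n n ℂ)).zero_mem
  have hζP : ∀ (y : Site d) (i : Fin d), ζ (y + ((M * N : ℕ) : ℤ) • e i) = ζ y := by
    intro y i
    have hcoord : ∀ k : Fin d, (y + ((M * N : ℕ) : ℤ) • e i) k = y k + (M : ℤ) * ((N : ℤ) * e i k) := by
      intro k; simp only [Pi.add_apply, Pi.smul_apply, smul_eq_mul]; push_cast; ring
    have hdiv_iff : (∀ k, (M : ℤ) ∣ (y + ((M * N : ℕ) : ℤ) • e i) k) ↔ ∀ k, (M : ℤ) ∣ y k := by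
      refine forall_congr' fun k => ?_
      rw [hcoord]
      constructor
      · intro h
        have h' := dvd_sub h (dvd_mul_right (M : ℤ) ((N : ℤ) * e i k))
        rwa [add_sub_cancel_right] at h'
      · intro h
        exact dvd_add h (dvd_mul_right _ _)
    by_cases hdiv : ∀ k, (M : ℤ) ∣ y k
    · rw [hζ_of _ (hdiv_iff.mpr hdiv), hζ_of _ hdiv]
      have hq : (fun k => (y + ((M * N : ℕ) : ℤ) • e i) k / (M : ℤ)) = (fun k => y k / (M : ℤ)) + (N : ℤ) • e i := by
        funext k
        rw [hcoord, Int.add_mul_ediv_left _ _ hM0]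
        simp only [Pi.add_apply, Pi.smul_apply, smul_eq_mul]
      rw [hq, hfP]
    · rw [hζ_off _ hdiv, hζ_off _ (fun h => hdiv (hdiv_iff.mp h))]
  have hζP_T : ∀ (y : Site d) (i : Fin d), ζ (y + ((tower L N (j + 1) : ℕ) : ℤ) • e i) = ζ y := by
    rw [htower]; exact hζP
  have hT := tangentIter_sub_gaugeDir_of_QbarIter_eq_zero (N := N) hL1 j hWu hWP_T le_rfl hs0 smallField_flatCfg_zero hYs hYP_T
    hQ hζs hζP_T hcorner'
  have hY'eq : Y - gaugeDir (flatCfg : Site d → Fin d → (Matrix n n ℂ)ˣ) ζ = fun y κ => Y y κ + dPot ζ y κ := by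
    funext y κ
    simp only [Pi.sub_apply, gaugeDir_flatCfg_eq_neg_dPot, sub_neg_eq_add]
  refine ⟨ζ, hζs, by rw [hPM]; exact hζP, ?_⟩
  rw [← hY'eq]
  exact hT

end

end Summit.QuantumFields.BalabanUV.T4Continuum.NE3.SlicB8FlatTangentRep
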